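import Literature.NumberTheory.LFunctions.MontgomeryPairCorrelationProofs
import Literature.NumberTheory.LFunctions.MontgomeryExplicitFormulaKernel
import Mathlib.NumberTheory.LSeries.Dirichlet
import HarnessLib

/-!
# Montgomery's explicit formula: the Dirichlet-series side

Trunk T-ANT (`Literature/NumberTheory/LFunctions`), second support file (after
`MontgomeryExplicitFormulaKernel.lean`) for the discharge of the named fact (P1)
`Literature.NumberTheory.LFunctions.montgomery_explicit_formula` (`MontgomeryPairCorrelation.lean`;
Montgomery 1973, Lemma; Goldston 2005, Proposition 1 (3.11)). Proofs only.

With the pair kernel `k(s) = 1/(s − s₁) − 1/(s − s₂)`, `s₁ = −1/2 + it`, `s₂ = 3/2 + it`, and a line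
`re s = c`, `1 < c < 3/2`, the Dirichlet-series side of the contour-integral explicit formula is

* `Montgomery.integral_neg_logDeriv_zeta_mul_kernel` :
  `∫ (−ζ'/ζ)(c+iy) x^{c+iy} k(c+iy) dy = 2π x^{it} ∑ₙ Λ(n) a_n(x) n^{−it}`
  (`= 2π x^{it} · montgomeryDirichletSum x t`), for every `x > 0` and real `t`,

obtained by expanding `−ζ'/ζ(s) = ∑ Λ(n) n^{−s}` (Mathlib's
`ArithmeticFunction.LSeries_vonMangoldt_eq_deriv_riemannZeta_div`), integrating termwise
(`MeasureTheory.integral_tsum_of_summable_integral_norm`; the `n`-th `L¹` norm is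
`Λ(n)(x/n)^c ∫|k(c+iy)| dy`, summable since `c > 1`), and evaluating each term by the Perron-type
formulas of `MontgomeryExplicitFormulaKernel.lean` with `y₀ = x/n`
(`Montgomery.integral_kernel_term`: `2π x^{it} a_n(x) n^{−it}` with
`a_n(x) = min((n/x)^{1/2}, (x/n)^{3/2})`, closing to the left for `n ≤ x` and to the right for
`n ≥ x`). This is the step "letting `s = 3/2 + it` … if `s = −1/2 + it`" of Goldston's proof of
Proposition 1, organised as a single contour integral between the two abscissae.

## References

* H. L. Montgomery, *The pair correlation of zeros of the zeta function*, Proc. Sympos. Pure Math.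
  24 (1973), 181–193, Lemma.
* D. A. Goldston, *Notes on pair correlation of zeros and prime numbers*, LMS Lecture Note Ser. 322
  (2005), Proposition 1, (3.11)–(3.14).
-/

noncomputable section

open Complex Filter Set MeasureTheory
open ArithmeticFunction hiding log id
open scoped Real Topology

namespace Literature.NumberTheory.LFunctions

namespace Montgomery

open Literature.Analysis.Complex

/-! ## Power bookkeeping for `(x/n)^{s}` -/

/-- For positive reals `x, n`: `(x/n)^w = x^w · n^{-w}` as complex powers. [folklore] -/
theorem div_ofReal_cpow {x n : ℝ} (hx : 0 < x) (hn : 0 < n) (w : ℂ) :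
    ((x / n : ℝ) : ℂ) ^ w = (x : ℂ) ^ w * (n : ℂ) ^ (-w) := by
  rw [div_eq_mul_inv, ofReal_mul, mul_cpow_ofReal_nonneg hx.le (inv_nonneg.2 hn.le), ofReal_inv,
    inv_cpow _ _ (by rw [arg_ofReal_of_nonneg hn.le]; exact Real.pi_ne_zero.symm), cpow_neg]

/-- For a positive real `y` and real `u, t`: `y^{u + it} = (y^u : ℝ) · y^{it}`. [folklore] -/
theorem ofReal_cpow_add_mul_I {y : ℝ} (hy : 0 < y) (u t : ℝ) :
    (y : ℂ) ^ ((u : ℂ) + t * I) = ((y ^ u : ℝ) : ℂ) * (y : ℂ) ^ ((t : ℂ) * I) := by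
  rw [cpow_add _ _ (ofReal_ne_zero.2 hy.ne'), ofReal_cpow hy.le]

/-- Montgomery's weight for `n ≤ x`: `min((n/x)^{1/2}, (x/n)^{3/2}) = (x/n)^{-1/2}`. [folklore] -/
theorem montgomeryWeight_of_le {x : ℝ} {n : ℕ} (hn : 0 < n) (hnx : (n : ℝ) ≤ x) :
    min (((n : ℝ) / x) ^ (1 / 2 : ℝ)) ((x / n) ^ (3 / 2 : ℝ)) = (x / n) ^ (-(1 / 2) : ℝ) := by
  have hn0 : (0 : ℝ) < n := by exact_mod_cast hn
  have hx0 : 0 < x := hn0.trans_le hnx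
  have h1 : ((n : ℝ) / x) ^ (1 / 2 : ℝ) = (x / n) ^ (-(1 / 2) : ℝ) := by
    rw [Real.rpow_neg (by positivity), ← Real.inv_rpow (by positivity), inv_div]
  rw [min_eq_left, h1]
  have hle : (n : ℝ) / x ≤ 1 := (div_le_one hx0).2 hnx
  have hge : 1 ≤ x / n := (one_le_div hn0).2 hnx
  calc ((n : ℝ) / x) ^ (1 / 2 : ℝ) ≤ 1 := Real.rpow_le_one (by positivity) hle (by norm_num)
    _ ≤ (x / n) ^ (3 / 2 : ℝ) := Real.one_le_rpow hge (by norm_num)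

/-- Montgomery's weight for `x ≤ n`: `min((n/x)^{1/2}, (x/n)^{3/2}) = (x/n)^{3/2}`. [folklore] -/
theorem montgomeryWeight_of_ge {x : ℝ} (hx0 : 0 < x) {n : ℕ} (hnx : x ≤ n) :
    min (((n : ℝ) / x) ^ (1 / 2 : ℝ)) ((x / n) ^ (3 / 2 : ℝ)) = (x / n) ^ (3 / 2 : ℝ) := by
  have hn0 : (0 : ℝ) < n := hx0.trans_le hnx
  rw [min_eq_right]
  have hle : x / n ≤ 1 := (div_le_one hn0).2 hnx
  have hge : 1 ≤ (n : ℝ) / x := (one_le_div hx0).2 hnx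
  calc (x / n) ^ (3 / 2 : ℝ) ≤ 1 := Real.rpow_le_one (by positivity) hle (by norm_num)
    _ ≤ ((n : ℝ) / x) ^ (1 / 2 : ℝ) := Real.one_le_rpow hge (by norm_num)

/-! ## The `n`-th term -/

/-- **The `n`-th term of the Dirichlet-series side.** For `x > 0`, `n ≥ 1`, real `t` and
`−1/2 < c < 3/2`:
`∫ (x/n)^{c+iy} (1/(c+iy−s₁) − 1/(c+iy−s₂)) dy = 2π x^{it} a_n(x) n^{−it}`, `s₁ = −1/2+it`,
`s₂ = 3/2+it`, `a_n(x) = min((n/x)^{1/2}, (x/n)^{3/2})` (close left for `n ≤ x`, right for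
`n ≥ x`). (Goldston 2005, proof of Proposition 1.) [cite: Goldston2005, Proposition 1 (3.11)] -/
theorem integral_kernel_term {x : ℝ} (hx : 0 < x) (t : ℝ) {c : ℝ} (hc1 : -1 / 2 < c) (hc2 : c < 3 / 2)
    {n : ℕ} (hn : 0 < n) :
    ∫ y : ℝ, ((x / n : ℝ) : ℂ) ^ ((c : ℂ) + y * I) *
        (1 / ((c : ℂ) + y * I - (-1 / 2 + t * I)) - 1 / ((c : ℂ) + y * I - (3 / 2 + t * I))) =
      2 * π * ((x : ℂ) ^ ((t : ℂ) * I) *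
        ((min (((n : ℝ) / x) ^ (1 / 2 : ℝ)) ((x / n) ^ (3 / 2 : ℝ)) : ℝ) : ℂ) *
          (n : ℂ) ^ (-((t : ℂ) * I))) := by
  have hn0 : (0 : ℝ) < n := by exact_mod_cast hn
  have hy0 : 0 < x / n := by positivity
  have ha : (-1 / 2 + t * I : ℂ).re < c := by simp; linarith
  have hb : c < (3 / 2 + t * I : ℂ).re := by simp; linarith
  have htI : ((x / n : ℝ) : ℂ) ^ ((t : ℂ) * I) = (x : ℂ) ^ ((t : ℂ) * I) * (n : ℂ) ^ (-((t : ℂ) * I)) :=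
    div_ofReal_cpow hx hn0 _
  rcases le_or_gt (n : ℝ) x with hnx | hnx
  · -- `n ≤ x`: close to the left, residue at `s₁`
    rw [integral_cpow_mul_inv_sub_inv_of_one_le ((one_le_div hn0).2 hnx) ha hb,
      montgomeryWeight_of_le hn hnx]
    have e : (-1 / 2 + t * I : ℂ) = ((-(1 / 2) : ℝ) : ℂ) + t * I := by push_cast; ring
    rw [e, ofReal_cpow_add_mul_I hy0, htI]
    ring
  · -- `x < n`: close to the right, residue at `s₂`
    rw [integral_cpow_mul_inv_sub_inv_of_le_one hy0 ((div_le_one hn0).2 hnx.le) ha hb,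
      montgomeryWeight_of_ge hx hnx.le]
    have e : (3 / 2 + t * I : ℂ) = (((3 / 2) : ℝ) : ℂ) + t * I := by push_cast; ring
    rw [e, ofReal_cpow_add_mul_I hy0, htI]
    ring


/-! ## The Dirichlet-series side -/

/-- **The Dirichlet-series side of Montgomery's explicit formula** (Goldston 2005, proof of
Proposition 1; Montgomery 1973, Lemma): for `x > 0`, real `t` and `1 < c < 3/2`,
`∫ (−ζ'/ζ)(c+iy) x^{c+iy} (1/(c+iy−s₁) − 1/(c+iy−s₂)) dy = 2π x^{it} ∑_n Λ(n) a_n(x) n^{−it}`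
(`= 2π x^{it} · montgomeryDirichletSum x t`): expand `−ζ'/ζ = ∑ Λ(n) n^{−s}`
(`ArithmeticFunction.LSeries_vonMangoldt_eq_deriv_riemannZeta_div`), integrate termwise
(`integral_tsum_of_summable_integral_norm`, the `n`-th `L¹` norm being `Λ(n)(x/n)^c ∫|kernel|`),
and use `integral_kernel_term`. [cite: Goldston2005, Proposition 1 (3.11)] -/
theorem integral_neg_logDeriv_zeta_mul_kernel {x : ℝ} (hx : 0 < x) (t : ℝ) {c : ℝ} (hc1 : 1 < c)
    (hc2 : c < 3 / 2) :
    ∫ y : ℝ, (-deriv riemannZeta ((c : ℂ) + y * I) / riemannZeta ((c : ℂ) + y * I)) *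
        ((x : ℂ) ^ ((c : ℂ) + y * I) *
          (1 / ((c : ℂ) + y * I - (-1 / 2 + t * I)) - 1 / ((c : ℂ) + y * I - (3 / 2 + t * I)))) =
      2 * π * ((x : ℂ) ^ ((t : ℂ) * I) * montgomeryDirichletSum x t) := by
  set a : ℂ := -1 / 2 + t * I with ha_def
  set b : ℂ := 3 / 2 + t * I with hb_def
  have ha : a.re < c := by rw [ha_def]; simp; linarith
  have hb : c < b.re := by rw [hb_def]; simp; linarith
  set K : ℝ → ℂ := fun y ↦ 1 / ((c : ℂ) + y * I - a) - 1 / ((c : ℂ) + y * I - b) with hK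
  set F : ℕ → ℝ → ℂ := fun n y ↦ LSeries.term (fun n ↦ (Λ n : ℂ)) ((c : ℂ) + y * I) n *
    ((x : ℂ) ^ ((c : ℂ) + y * I) * K y) with hF
  have hterm : ∀ n : ℕ, 0 < n → ∀ y : ℝ, F n y =
      (Λ n : ℂ) * (((x / n : ℝ) : ℂ) ^ ((c : ℂ) + y * I) * K y) := by
    intro n hn y
    have hn0 : (0 : ℝ) < n := by exact_mod_cast hn
    rw [hF]
    dsimp only
    rw [LSeries.term_of_ne_zero hn.ne', div_ofReal_cpow hx hn0, div_eq_mul_inv, ← cpow_neg,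
      ofReal_natCast]
    ring
  have hF0 : ∀ y, F 0 y = 0 := fun y ↦ by simp [hF]
  -- pointwise: the integrand is `∑' n, F n y`
  have hsum_y : ∀ y : ℝ, HasSum (fun n ↦ F n y)
      ((-deriv riemannZeta ((c : ℂ) + y * I) / riemannZeta ((c : ℂ) + y * I)) *
        ((x : ℂ) ^ ((c : ℂ) + y * I) * K y)) := by
    intro y
    have hs : 1 < ((c : ℂ) + y * I).re := by simp; linarith
    have h1 := (ArithmeticFunction.LSeriesSummable_vonMangoldt hs).hasSum
    rw [show (∑' n, LSeries.term (fun n ↦ (Λ n : ℂ)) ((c : ℂ) + y * I) n) =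
      LSeries (fun n ↦ (Λ n : ℂ)) ((c : ℂ) + y * I) from rfl,
      ArithmeticFunction.LSeries_vonMangoldt_eq_deriv_riemannZeta_div hs] at h1
    exact h1.mul_right _
  -- integrability of each term
  have hFint : ∀ n, Integrable (F n) := by
    intro n
    rcases Nat.eq_zero_or_pos n with rfl | hn
    · have h0 : F 0 = fun _ ↦ 0 := funext hF0
      rw [h0]; exact integrable_zero _ _ _
    · have hn0 : (0 : ℝ) < n := by exact_mod_cast hn
      have h := (integrable_cpow_mul_inv_sub_inv (y₀ := x / n) (by positivity) (c := c)
        ha.ne hb.ne').const_mul (Λ n : ℂ)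
      exact h.congr (ae_of_all _ fun y ↦ (hterm n hn y).symm)
  -- the `L¹` norms
  have hKint : Integrable K := VLI.integrable_inv_sub_inv ha.ne hb.ne'
  set J : ℝ := ∫ y, ‖K y‖ with hJ
  have hnormF : ∀ n, 0 < n → ∫ y, ‖F n y‖ = Λ n * (x / n) ^ c * J := by
    intro n hn
    have hn0 : (0 : ℝ) < n := by exact_mod_cast hn
    have : ∀ y, ‖F n y‖ = Λ n * (x / n) ^ c * ‖K y‖ := fun y ↦ by
      rw [hterm n hn y, norm_mul, norm_mul, Complex.norm_real, Real.norm_of_nonneg vonMangoldt_nonneg,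
        norm_cpow_vertical (by positivity)]
      ring
    simp_rw [this]
    exact MeasureTheory.integral_const_mul _ _
  have hsumm : Summable fun n ↦ ∫ y, ‖F n y‖ := by
    have hc' : 1 < (c : ℂ).re := by simp; linarith
    have h1 : Summable fun n : ℕ ↦ ‖LSeries.term (fun n ↦ (Λ n : ℂ)) (c : ℂ) n‖ :=
      (ArithmeticFunction.LSeriesSummable_vonMangoldt hc').norm
    refine (h1.mul_left (x ^ c * J)).congr fun n ↦ ?_
    rcases Nat.eq_zero_or_pos n with rfl | hn
    · simp [hF0]
    · have hn0 : (0 : ℝ) < n := by exact_mod_cast hn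
      rw [hnormF n hn, LSeries.norm_term_eq, if_neg hn.ne', Complex.norm_real,
        Real.norm_of_nonneg vonMangoldt_nonneg, ofReal_re, Real.div_rpow hx.le hn0.le]
      field_simp
  -- termwise evaluation
  have heval : ∀ n, ∫ y, F n y =
      2 * π * ((x : ℂ) ^ ((t : ℂ) * I) * ((montgomeryCoeff x n : ℂ) * (n : ℂ) ^ (-((t : ℂ) * I)))) := by
    intro n
    rcases Nat.eq_zero_or_pos n with rfl | hn
    · simp [hF0]
    · rw [integral_congr_ae (ae_of_all _ (hterm n hn)), MeasureTheory.integral_const_mul, hK,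
        integral_kernel_term hx t (by linarith) hc2 hn]
      simp only [montgomeryCoeff]
      push_cast
      ring
  calc ∫ y : ℝ, (-deriv riemannZeta ((c : ℂ) + y * I) / riemannZeta ((c : ℂ) + y * I)) *
        ((x : ℂ) ^ ((c : ℂ) + y * I) * K y)
      = ∫ y, ∑' n, F n y := integral_congr_ae (ae_of_all _ fun y ↦ ((hsum_y y).tsum_eq).symm)
    _ = ∑' n, ∫ y, F n y := (integral_tsum_of_summable_integral_norm hFint hsumm).symm
    _ = ∑' n, 2 * π * ((x : ℂ) ^ ((t : ℂ) * I) *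
          ((montgomeryCoeff x n : ℂ) * (n : ℂ) ^ (-((t : ℂ) * I)))) := tsum_congr heval
    _ = 2 * π * ((x : ℂ) ^ ((t : ℂ) * I) * montgomeryDirichletSum x t) := by
        rw [tsum_mul_left, tsum_mul_left]
        rfl

end Montgomery
end Literature.NumberTheory.LFunctions
end
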